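import Literature.AnabelianGeometry.EtaleTheta.Discharge.Sec2InvEllOfCLevel
import Literature.AnabelianGeometry.EtaleTheta.SettingModelTateMuTwoCusp
import Literature.AnabelianGeometry.EtaleTheta.SettingModelTateCensusClauses
import Literature.AnabelianGeometry.EtaleTheta.SettingModelTateThetaCuspOncePunctured
import HarnessLib

/-!
# [EtTh] Prop. 2.2 (i) eigenvalue binders `hιell` / `hιtheta` in CONSUMER FORM at a `MuTwoSetting`-derived `Π_C`:
# the CUSPED stage-2 record `MuTwoSetting.modelχq′` (R78; census C4 / G-L2t10-4; L2-lead R290 (i))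

S. Mochizuki, *The étale theta function …*, Publ. RIMS **45** (2009) [EtTh], §2, Prop. 2.2 (i) p. 37 («`ι` acts on
`Δ̄^ell_X` by `−1`», «on `Δ̄_Θ` by `+1`»), Def. 1.7 p. 27 (`ε_±`) [cite: MochizukiEtTh2009, Prop 2.2 (i) p.37].  abc-iut cell, layer
L2, seat abc-iut-w5-d029 (gen 5).  PROOF-ONLY (0 definitions, 0 instances).

abc-iut-L2-d3's `MuTwoSetting.CLevelData.piCData_inv_ell_of_hinv` / `piCData_inv_theta_of_hinv` (`Sec2InvEllOfCLevel`) reduce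
the two Prop. 2.2 (i) binders of `coverDataAx` at THE profinite `Π_C := e.PiCHat` of a C-level datum to: (P1) (carried by an
`OncePuncturedData`), ONE geometric `g ∉ Π^tp_X` of `Π^tp_C`, and (R1e′) «`ι̂ ≡ −1` on `Δ_X^ab`» for `ι := e.conjX g`.  At the
cusp-LESS roots only the `Δ_X`-form was available (`OncePuncturedData` is EMPTY there, §4 of that file).  At this seat's CUSPED
stage-2 record all three inputs are in the tree BY NAME: `OncePuncturedData` (abc-iut-w5-d111, `nonempty_oncePuncturedData_modelχq'`),
`g := ε_± = inr 1̄ ∉ Π^tp_X` with `augC ε_± = 1` (the record's C-level datum `modelχq'_cLevelData`, abc-iut-w5-d249's `augCq`),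
and (R1e′) for `e.conjX ε_± = inversionχq` (abc-iut-w5-d249's `epsPM_conj_inlCq`; abc-iut-L2-t10's `inversionχq_hinv'`).  Hence:

* `conjX_epsPM_modelχq'` — `e.conjX ε_± = ι` for EVERY C-level datum of the cusped record;
* **`piCData_inv_ell_modelχq'`** — for `E := modelχq'_cLevelData`: `∀ c ∈ Ker(Π_C ↠ G_K), c ∉ Π_X → ∀ d ∈ Π_X ∩ Ker,
  c·d·c⁻¹·d ∈ barTheta l` — the binder `hιell` of `coverDataAx` in its CONSUMER form, every `l`, every `i`, even `j`;
* **`piCData_inv_theta_modelχq'`** — the binder `hιtheta` likewise (abc-iut-L6-d6's commutator pairing);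
* `exists_muTwo_cLevelData_piCData_inv_ell_and_inv_theta` — census form: a `MuTwoSetting` with C-level data, a cusp and
  `OncePuncturedData` whose `Π_C` satisfies BOTH binders (census C4: «not derivable from `MuTwoSetting`» — here DERIVED at a
  `MuTwoSetting` from (R1e′) + (P1), as the reduction says).

HONEST LABEL: semi-synthetic model (Tate-module type Galois action; synthetic `b`-axis cusp) — consistency evidence for the typed
interface only; nothing of [EtTh] asserted; no side taken on [IUTchIII] Cor. 3.12; typed ≠ proved.
-/

noncomputable section

namespace Literature.AnabelianGeometry.EtaleTheta.SettingModel

open Literature.AnabelianGeometry.SemiGraphs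

variable (p : ℕ) [Fact p.Prime] (i j : ℤ) (hj : Even j)

/-- **`e.conjX ε_± = ι`** for every C-level datum `e` of the cusped stage-2 record (conjugation by `ε_± = inr 1̄` on
`Π^tp_X ⋊_ι ℤ/2` is `ι`). [cite: MochizukiEtTh2009, Def 1.7 p.27] -/
theorem conjX_epsPM_modelχq' (e : (MuTwoSetting.modelχq' p i j hj).CLevelData) :
    e.conjX (MuTwoSetting.modelχq' p i j hj).epsPM = inversionχq p i j := by
  refine ContinuousMulEquiv.ext fun x => (MuTwoSetting.modelχq' p i j hj).injective_inclX ?_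
  rw [e.inclX_conjX]
  exact MuTwoSetting.modelχq'_epsPM_conj p i j hj x

/-- `augC ε_± = 1` for the record's C-level datum (`augC = aug ⋊ 1`). [cite: MochizukiEtTh2009, §2 p.36] -/
theorem augC_epsPM_modelχq'_cLevelData :
    (MuTwoSetting.modelχq'_cLevelData p i j hj).augC (MuTwoSetting.modelχq' p i j hj).epsPM = 1 := by
  change augCq p i j (SemidirectProduct.inr (Multiplicative.ofAdd 1)) = 1
  rw [augCq_apply, SemidirectProduct.left_inr, map_one]

/-- (R1e′) for `ι := e.conjX ε_±` at the cusped stage-2 record: `ι̂ y · y ∈ ⁅Δ_X, Δ_X⁆⁻` for every `y ∈ Δ_X`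
(abc-iut-L2-t10's `inversionχq_hinv'`). [cite: MochizukiEtTh2009, Prop 2.2 (i) p.37] -/
theorem completionAut_conjX_epsPM_hinv_modelχq' (e : (MuTwoSetting.modelχq' p i j hj).CLevelData) :
    ∀ y ∈ (MuTwoSetting.modelχq' p i j hj).DeltaHat,
      (MuTwoSetting.modelχq' p i j hj).completionAut (e.conjX (MuTwoSetting.modelχq' p i j hj).epsPM) y * y ∈
        (⁅(MuTwoSetting.modelχq' p i j hj).DeltaHat, (MuTwoSetting.modelχq' p i j hj).DeltaHat⁆).topologicalClosure := by
  rw [conjX_epsPM_modelχq']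
  exact inversionχq_hinv' p i j

/-- **`hιell` in CONSUMER FORM at `Π_C := (modelχq'_cLevelData).PiCHat`**: for every `c ∈ Ker(Π_C ↠ G_K)` outside `Π_X` and
every `d ∈ Π_X ∩ Ker(Π_C ↠ G_K)`, `c·d·c⁻¹·d ∈ barTheta l` («`ι` acts on `Δ̄^ell_X` by `−1`»).
[cite: MochizukiEtTh2009, Prop 2.2 (i) p.37] -/
theorem piCData_inv_ell_modelχq' (l : ℕ) :
    ∀ c ∈ (MuTwoSetting.modelχq'_cLevelData p i j hj).piCData.augGK.ker,
      c ∉ (MuTwoSetting.modelχq'_cLevelData p i j hj).piCData.PiX →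
        ∀ d ∈ (MuTwoSetting.modelχq'_cLevelData p i j hj).piCData.PiX ⊓
            (MuTwoSetting.modelχq'_cLevelData p i j hj).piCData.augGK.ker,
          c * d * c⁻¹ * d ∈ (MuTwoSetting.modelχq'_cLevelData p i j hj).piCData.barTheta l :=
  (MuTwoSetting.modelχq'_cLevelData p i j hj).piCData_inv_ell_of_hinv
    (nonempty_oncePuncturedData_modelχq' p i j hj).some l (augC_epsPM_modelχq'_cLevelData p i j hj)
    (MuTwoSetting.modelχq' p i j hj).epsPM_not_mem (completionAut_conjX_epsPM_hinv_modelχq' p i j hj _)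

/-- **`hιtheta` in CONSUMER FORM at the same `Π_C`**: `c·t·c⁻¹·t⁻¹ ∈ barKer l` for `t ∈ barTheta l` («`ι` acts on `Δ̄_Θ` by
`+1`»). [cite: MochizukiEtTh2009, Prop 2.2 (i) p.37] -/
theorem piCData_inv_theta_modelχq' (l : ℕ) :
    ∀ c ∈ (MuTwoSetting.modelχq'_cLevelData p i j hj).piCData.augGK.ker,
      c ∉ (MuTwoSetting.modelχq'_cLevelData p i j hj).piCData.PiX →
        ∀ t ∈ (MuTwoSetting.modelχq'_cLevelData p i j hj).piCData.barTheta l,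
          c * t * c⁻¹ * t⁻¹ ∈ (MuTwoSetting.modelχq'_cLevelData p i j hj).piCData.barKer l :=
  (MuTwoSetting.modelχq'_cLevelData p i j hj).piCData_inv_theta_of_hinv
    (nonempty_oncePuncturedData_modelχq' p i j hj).some l (augC_epsPM_modelχq'_cLevelData p i j hj)
    (MuTwoSetting.modelχq' p i j hj).epsPM_not_mem (completionAut_conjX_epsPM_hinv_modelχq' p i j hj _)

include hj in
/-- **Census form (C4 / G-L2t10-4)**: for every `i` and even `j` there is a `MuTwoSetting` over the cusped stage-2 carrier with a
C-level datum `e` and `OncePuncturedData`, at whose `Π_C := e.PiCHat` BOTH Prop. 2.2 (i) eigenvalue binders hold in consumer form —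
derived at a `MuTwoSetting` from (R1e′) + (P1). [cite: MochizukiEtTh2009, Prop 2.2 (i) p.37] -/
theorem _root_.Literature.AnabelianGeometry.EtaleTheta.MuTwoSetting.exists_muTwo_cLevelData_piCData_inv_ell_and_inv_theta
    (l : ℕ) :
    ∃ (M : MuTwoSetting p) (e : M.CLevelData), M.toTemperedCurve = curveχq' p i j ∧
      Nonempty M.toThetaSetting.OncePuncturedData ∧
      (∀ c ∈ e.piCData.augGK.ker, c ∉ e.piCData.PiX →
        ∀ d ∈ e.piCData.PiX ⊓ e.piCData.augGK.ker, c * d * c⁻¹ * d ∈ e.piCData.barTheta l) ∧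
      (∀ c ∈ e.piCData.augGK.ker, c ∉ e.piCData.PiX →
        ∀ t ∈ e.piCData.barTheta l, c * t * c⁻¹ * t⁻¹ ∈ e.piCData.barKer l) :=
  ⟨MuTwoSetting.modelχq' p i j hj, MuTwoSetting.modelχq'_cLevelData p i j hj, rfl,
    nonempty_oncePuncturedData_modelχq' p i j hj, piCData_inv_ell_modelχq' p i j hj l, piCData_inv_theta_modelχq' p i j hj l⟩

end Literature.AnabelianGeometry.EtaleTheta.SettingModel

end
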